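import Literature.NumberTheory.EllipticCurves.DeligneSerreProp27HigherWeightProofs
import HarnessLib

/-!
# Integrality of the Hecke polynomial of a newform on `Γ₁(N)`: weights `k ≥ 2` unconditionally,
# and the whole fact from Deligne–Serre's (2.7.2) in weights `5` and `7`

A *proofs* companion (theorems only: no definition, no named fact, nothing restated) to
`Literature.NumberTheory.EllipticCurves.NewformGaloisRepIntegralityProofs`, which reduces the named
fact `IsNewform1.exists_map_eq_heckePolynomial` of `NewformGaloisRep` — *for a newform
`f ∈ S_k(Γ₁(N))`, `k ≥ 1`, and every `q`, the Hecke polynomial `X² − a_q X + ε(q) q^{k−1} ∈ K_f[X]`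
lifts to `𝓞_f[X]`* (Deligne–Serre 1974, §8.2 with Prop. 2.7, p. 512 and p. 525; Shimura 1971,
Thm. 3.48 for `k ≥ 2`) — to the spanning statement (2.7.2), `DeligneSerre1974_span_integralLattice1 N k`,
in the *same* weight `k` (`IsNewform1.exists_map_eq_heckePolynomial_of_span_integralLattice1`).

This file records the sharper state of that reduction, using the unconditional operator
integrality in weights `≥ 2` of `DeligneSerreProp27HigherWeightProofs`
(`isIntegral_of_heckeT_gamma1_apply_eq_smul_of_two_le`: the transpose of `T_p` preserves the
finitely generated, separating Eichler–Shimura period lattice `periodLatticeK1`, Shimura 1971,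
Thm. 3.48 (3) with (3.5.20) and §8.4):

* `IsNewform1.isIntegral_cuspCoeff_of_two_le` — **the Fourier coefficients of a newform of weight
  `k ≥ 2` on `Γ₁(N)` are algebraic integers, unconditionally** (Shimura 1971, Thm. 3.48;
  Diamond–Shurman Thm. 6.5.1 in weight `2`): `a_p` as the `T_p`-eigenvalue
  (`IsNewform1.heckeEigenvalue_eq_coeff_holds`), prime powers and coprime products by the proved
  Hecke relations (`IsNewform1.cuspCoeff_prime_pow_add_two_holds`,
  `IsNewform1.cuspCoeff_mul_of_coprime_holds`), `a₀ = 0`, `a₁ = 1` — the argument of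
  `IsNewform1.isIntegral_cuspCoeff` with the hypothesis (2.7.2) replaced by the period lattice;
* `IsNewform1.exists_map_eq_heckePolynomial_of_two_le` — **the `k ≥ 2` part of the named fact,
  unconditionally**;
* `IsNewform1.exists_map_eq_heckePolynomial_of_weight_one` — hence the named fact (all weights) is
  implied by its weight-one case (weights `≤ 0` never occur under the fact's hypothesis `1 ≤ k`);
* `IsNewform1.exists_map_eq_heckePolynomial_of_five_seven` — and therefore by (2.7.2) in the two
  weights `5` and `7` of the same level (`DeligneSerre1974_span_integralLattice1.weight_one_of_five_seven`,
  division by `E₄` and `E₆`, `DeligneSerreProp27WeightReductionProofs`; Deligne–Serre Rem. 2.8),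
  sharpening `IsNewform1.exists_map_eq_heckePolynomial_of_span_integralLattice1_of_le`, which asks
  for (2.7.2) in all weights `≥ K₀`.

So the residual content of `IsNewform1.exists_map_eq_heckePolynomial` is exactly its weight-one
case, and the only unproved input behind it in the tree is the existing named fact
`DeligneSerre1974_span_integralLattice1` (in weights `5` and `7`), itself reduced in
`DeligneSerreProp27RealLatticeProofs` to the rank statement of the Eichler–Shimura isomorphism for
`Γ₁(N)` (Shimura 1971, Thm. 8.4 / Prop. 8.6).  Its discharge `exists_map_eq_heckePolynomial_holds`
is `IsNewform1.exists_map_eq_heckePolynomial_of_five_seven` applied to the discharges of those two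
instances, once they exist; no further decomposition of the fact is needed.

## What is not here

Weight one is not discharged: no Hecke-stable integral structure on `S_1(Γ₁(N))` is available
short of (2.7.2) (Deligne–Serre obtain it from the modular stack and the Tate curve, (2.6.1) and
Rem. 2.8); multiplication by `Δ`, `E₄`, `E₆` transports the rational structure, not the Hecke
action, so the operator integrality of weights `≥ 2` does not descend.

## References

* P. Deligne, J.-P. Serre, *Formes modulaires de poids 1*, Ann. Sci. ÉNS (4) 7 (1974), 507–530,
  doi:10.24033/asens.1277: Prop. 2.7 and Rem. 2.8 (p. 512), §8.2 (p. 525). [DeligneSerreASENS1974]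
* G. Shimura, *Introduction to the arithmetic theory of automorphic functions*, Publ. Math. Soc.
  Japan 11, Iwanami Shoten / Princeton UP, 1971: Thm. 3.48 ("Suppose that `k ≥ 2`"), (3.5.20)
  (pp. 83–84). [Shimura1971]
* F. Diamond, J. Shurman, *A first course in modular forms*, GTM 228, Springer 2005: Prop. 5.8.5,
  Thm. 6.5.1. [DiamondShurman2005]
-/

noncomputable section

open scoped MatrixGroups ModularForm NumberField

open CongruenceSubgroup UpperHalfPlane Polynomial

namespace Literature.NumberTheory.EllipticCurves.ModularForms

variable {N : ℕ} [NeZero N] {k : ℤ}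

/-- For a newform `f ∈ S_k(Γ₁(N))` of weight `k ≥ 2` and a prime `p`, the coefficient `a_p(f)` is
an algebraic integer, unconditionally: `T_p f = a_p f` (`IsNewform1.heckeEigenvalue_eq_coeff_holds`,
Diamond–Shurman Prop. 5.8.5), `f ≠ 0`, and `T_p` is integral over `ℤ` on `S_k(Γ₁(N))` for `k ≥ 2`
(`isIntegral_of_heckeT_gamma1_apply_eq_smul_of_two_le`, the period lattice; Shimura 1971,
Thm. 3.48 (3)). [cite: Shimura1971, Thm. 3.48 (3)] -/
theorem IsNewform1.isIntegral_cuspCoeff_prime_of_two_le (hk : 2 ≤ k)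
    {f : CuspForm (Gamma1 N) k} (hf : IsNewform1 f) {p : ℕ} (hp : p.Prime) :
    IsIntegral ℤ (cuspCoeff f p) := by
  haveI : NeZero p := ⟨hp.ne_zero⟩
  have heig := heckeT_eq_heckeEigenvalue_smul f p (hf.2.1 p hp)
  rw [IsNewform1.heckeEigenvalue_eq_coeff_holds hf hp] at heig
  exact isIntegral_of_heckeT_gamma1_apply_eq_smul_of_two_le hk hp hf.ne_zero heig

/-- For a newform `f ∈ S_k(Γ₁(N))` of weight `k ≥ 2`, the coefficients `a_{p^r}(f)` (`p` prime)
are algebraic integers, unconditionally: two-step induction on `r` with the Hecke recursion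
`a_{p^{r+2}} = a_p a_{p^{r+1}} − ε(p) p^{k−1} a_{p^r}` (`IsNewform1.cuspCoeff_prime_pow_add_two_holds`,
Diamond–Shurman Prop. 5.8.5 (2)), `a_1 = 1`, and the integrality of `a_p`
(`isIntegral_cuspCoeff_prime_of_two_le`) and of `ε(p) p^{k−1}` (`isIntegral_nebentypus_mul_zpow`).
[cite: DiamondShurman2005, Prop. 5.8.5 (2)] -/
theorem IsNewform1.isIntegral_cuspCoeff_prime_pow_of_two_le (hk : 2 ≤ k)
    {f : CuspForm (Gamma1 N) k} (hf : IsNewform1 f) {p : ℕ} (hp : p.Prime) (r : ℕ) :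
    IsIntegral ℤ (cuspCoeff f (p ^ r)) := by
  have hε := isIntegral_nebentypus_mul_zpow f (show (1 : ℤ) ≤ k by omega) p
  have hp1 := hf.isIntegral_cuspCoeff_prime_of_two_le hk hp
  have key : ∀ r : ℕ,
      IsIntegral ℤ (cuspCoeff f (p ^ r)) ∧ IsIntegral ℤ (cuspCoeff f (p ^ (r + 1))) := by
    intro r
    induction r with
    | zero =>
      refine ⟨?_, by simpa using hp1⟩
      rw [pow_zero, show cuspCoeff f 1 = 1 from hf.2.2.2]
      exact isIntegral_one
    | succ r ih =>
      refine ⟨ih.2, ?_⟩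
      rw [show r + 1 + 1 = r + 2 from rfl, IsNewform1.cuspCoeff_prime_pow_add_two_holds hf hp r]
      exact (hp1.mul ih.2).sub (hε.mul ih.1)
  exact (key r).1

/-- **The Fourier coefficients of a newform of weight `k ≥ 2` on `Γ₁(N)` are algebraic integers,
unconditionally** (all `n ≥ 0`; Shimura 1971, Thm. 3.48; Diamond–Shurman Thm. 6.5.1 in weight `2`;
Deligne–Serre 1974, (2.7.3) with §8.2): induction over the factorisation of `n`
(`Nat.recOnPosPrimePosCoprime`) — `a_0 = 0` (cusp form), `a_1 = 1`, prime powers by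
`isIntegral_cuspCoeff_prime_pow_of_two_le`, coprime products by multiplicativity
(`IsNewform1.cuspCoeff_mul_of_coprime_holds`, Diamond–Shurman Prop. 5.8.5 (3)).  The unconditional
weight-`≥ 2` form of `IsNewform1.isIntegral_cuspCoeff` (which assumes (2.7.2)); the `Γ₁(N)`
companion of the discharged `IsNewform0.isIntegral_coeff_holds`. [cite: Shimura1971, Thm. 3.48] -/
theorem IsNewform1.isIntegral_cuspCoeff_of_two_le (hk : 2 ≤ k) {f : CuspForm (Gamma1 N) k}
    (hf : IsNewform1 f) (n : ℕ) : IsIntegral ℤ (cuspCoeff f n) := by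
  induction n using Nat.recOnPosPrimePosCoprime with
  | zero =>
    rw [show cuspCoeff f 0 = 0 from
      CuspFormClass.qExpansion_coeff_zero f one_pos (HeckeTGamma1.one_mem_strictPeriods_Gamma1 N)]
    exact isIntegral_zero
  | one =>
    rw [show cuspCoeff f 1 = 1 from hf.2.2.2]
    exact isIntegral_one
  | prime_pow p r hp hr => exact hf.isIntegral_cuspCoeff_prime_pow_of_two_le hk hp r
  | coprime a b ha hb hab iha ihb =>
    rw [IsNewform1.cuspCoeff_mul_of_coprime_holds hf hab]
    exact iha.mul ihb

/-- **The `k ≥ 2` part of `IsNewform1.exists_map_eq_heckePolynomial`, unconditionally.**  For a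
newform `f ∈ S_k(Γ₁(N))`, `k ≥ 2`, and every `q : ℕ`, the Hecke polynomial
`X² − a_q X + ε(q) q^{k−1} ∈ K_f[X]` is the image of `X² − a_q X + ε(q) q^{k−1} ∈ 𝓞_f[X]`: `a_q` is
an algebraic integer by `IsNewform1.isIntegral_cuspCoeff_of_two_le` and `ε(q) q^{k−1}` by
`isIntegral_nebentypus_mul_zpow` (Shimura 1971, Thm. 3.48 (3): "the characteristic polynomial of
`[X]_k` … has rational integral coefficients", `k ≥ 2`; Deligne–Serre 1974, §8.2).
[cite: Shimura1971, Thm. 3.48 (3)] -/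
theorem IsNewform1.exists_map_eq_heckePolynomial_of_two_le (hk : 2 ≤ k)
    {f : CuspForm (Gamma1 N) k} : IsNewform1.exists_map_eq_heckePolynomial (f := f) := by
  intro hf _ q
  have ha : IsIntegral ℤ
      (⟨(qExpansion 1 ⇑f).coeff q, cuspCoeff_mem_coeffCharField f q⟩ : coeffCharField f) :=
    (isIntegral_coeffCharField_iff f).mpr (hf.isIntegral_cuspCoeff_of_two_le hk q)
  have hc : IsIntegral ℤ (⟨(nebentypus f (q : ZMod N) : ℂ) * (q : ℂ) ^ (k - 1),
      nebentypus_mul_zpow_mem_coeffCharField f q⟩ : coeffCharField f) :=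
    (isIntegral_coeffCharField_iff f).mpr
      (isIntegral_nebentypus_mul_zpow f (show (1 : ℤ) ≤ k by omega) q)
  refine ⟨X ^ 2 - C ⟨_, ha⟩ * X + C ⟨_, hc⟩, ?_⟩
  simp only [heckePolynomial, Polynomial.map_add, Polynomial.map_sub, Polynomial.map_mul,
    Polynomial.map_pow, Polynomial.map_X, Polynomial.map_C]
  rfl

/-- **`IsNewform1.exists_map_eq_heckePolynomial` is implied by its weight-one case**: under the
fact's hypothesis `1 ≤ k`, either `k = 1` or `k ≥ 2`, and the latter is unconditional
(`IsNewform1.exists_map_eq_heckePolynomial_of_two_le`).  Weight one is the case Deligne–Serre need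
(§8.2) and the one in which no Hecke-stable integral structure short of (2.7.2) is available. [folklore] -/
theorem IsNewform1.exists_map_eq_heckePolynomial_of_weight_one
    (h1 : ∀ g : CuspForm (Gamma1 N) 1, IsNewform1.exists_map_eq_heckePolynomial (f := g))
    {f : CuspForm (Gamma1 N) k} : IsNewform1.exists_map_eq_heckePolynomial (f := f) := by
  intro hf hk q
  rcases eq_or_lt_of_le hk with hk1 | hk2
  · subst hk1
    exact h1 f hf hk q
  · exact IsNewform1.exists_map_eq_heckePolynomial_of_two_le (show (2 : ℤ) ≤ k by omega) hf hk q

/-- **`IsNewform1.exists_map_eq_heckePolynomial` (every weight) from Deligne–Serre's (2.7.2) in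
weights `5` and `7` of the same level.**  (2.7.2) in weights `5` and `7` gives (2.7.2) in weight
`1` (`DeligneSerre1974_span_integralLattice1.weight_one_of_five_seven`: division by `E₄`, `E₆`, a
form of Deligne–Serre's Rem. 2.8 "ramener le poids 1 au poids 13 par multiplication par `Δ`"),
whence the weight-one case by `IsNewform1.exists_map_eq_heckePolynomial_of_span_integralLattice1`;
the other weights need nothing (`IsNewform1.exists_map_eq_heckePolynomial_of_weight_one`).  Once
`DeligneSerre1974_span_integralLattice1` is discharged (in weights `5`, `7`),
`exists_map_eq_heckePolynomial_holds` is this theorem applied to those discharges. [cite: DeligneSerreASENS1974, Prop. 2.7 (2.7.2) and Rem. 2.8 (p. 512), §8.2 (p. 525)] -/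
theorem IsNewform1.exists_map_eq_heckePolynomial_of_five_seven
    (h5 : DeligneSerre1974_span_integralLattice1 N 5)
    (h7 : DeligneSerre1974_span_integralLattice1 N 7) {f : CuspForm (Gamma1 N) k} :
    IsNewform1.exists_map_eq_heckePolynomial (f := f) :=
  IsNewform1.exists_map_eq_heckePolynomial_of_weight_one fun _ ↦
    IsNewform1.exists_map_eq_heckePolynomial_of_span_integralLattice1
      (DeligneSerre1974_span_integralLattice1.weight_one_of_five_seven h5 h7)

end Literature.NumberTheory.EllipticCurves.ModularForms
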